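import Literature.NumberTheory.EllipticCurves.TwoAdicImageModFourClauseTwoReductionProofs
import Literature.NumberTheory.EllipticCurves.TwoAdicImageSurjectivityModFourProofs
import Literature.NumberTheory.EllipticCurves.TwoAdicImageSurjectivityProofs
import Literature.NumberTheory.EllipticCurves.HeegnerPointsKolyvaginConjugation
import Literature.NumberTheory.EllipticCurves.HeegnerPointsImaginaryQuadraticProofs
import Literature.NumberTheory.QuadraticFields.DiscriminantOfSqrt
import Summits.BirchSwinnertonDyer.BirchSwinnertonDyer.Theorems.GenusKolyvaginAtTwoEquivariantChebotarevAtTwoOffDiscField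
import Literature.NumberTheory.EllipticCurves.TwoTorsionOddDegreeBaseChangeProofs
import HarnessLib

/-!
# Route `GenusKolyvaginAtTwo`, crux `GenusPrimitiveSupplyAtTwo` (stmt-BirchSwinnertonDyer-22136):
# the `2`-ADIC IMAGE OVER THE HEEGNER FIELD — `ρ̄_{E,2ⁿ}` onto over `ℚ` for all `n` and the crux's
# three side conditions on `d_K` ⟹ `ρ̄_{E,2ⁿ} : Γ_K → Aut E[2ⁿ]` onto over `K` for all `n`

Seat `bsd-line-gk2-p5` g13 (WIDTH-5 attach, SUPPLY lineage; helper `--supports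
stmt-BirchSwinnertonDyer-22136`). THEOREMS ONLY: no definition, no named fact, no `sorry`; no item is
closed; BSD is not proved by any of this.

WHY. The crux `GenusPrimitiveSupplyAtTwo` (and its kernel (U) `MultiGenusPrimitivityAtTwo`) quantify
over a Heegner field `K` with `d_K` ODD and the two side conditions `d_K·(−|Δ|) ∉ ℚ²`,
`d_K·(−2|Δ|) ∉ ℚ²`, while the habitat gives the `2`-adic image ONLY OVER `ℚ`
(`∀ n, 0 < n → W.HasSurjectiveModNGaloisRep (2^n)`). Every big-image input of the `p = 2` Kolyvagin
machine lives OVER `K` (`W.baseChange K`): the LEAD's Lawson–Wuthrich files at the even prime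
(`LawsonWuthrich2016.two_zsmul_eq_zero_of_forall_h1Eval_eq_zero_of_hasSurjectiveModNGaloisRep`,
`LawsonWuthrich2016.natCard_subgroupResKer_two_pow_le_two`: hypothesis `HasSurjectiveModNGaloisRep`
over the base field of the `H¹`), LINE 6's (H2′), Gross §9 at level `2^k`. The LEAD named the missing
glue (memo `Cruxes/GenusPrimitiveSupplyAtTwo/Lines/genus-supply-g11.md` §2, §4 (2)): *"for `K`
imaginary quadratic this is `2^k`-surjectivity OVER `K` — from surjectivity over `ℚ` plus
`K ∩ ℚ(E[2^k]) = ℚ`, which is what the crux's side conditions `d_K·(−Δ), d_K·(−2Δ) ∉ ℚ²` and `d_K` odd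
are for; that transfer is NOT in these files"*. This file proves it:

* `hasSurjectiveModNGaloisRep_baseChange_two_pow` — **for `W/ℚ` elliptic with `ρ̄_{W,2ⁿ}` onto for all
  `n ≥ 1`, and `K` imaginary quadratic with `d_K` odd, `d_K·(−|Δ|) ∉ ℚ²`, `d_K·(−2|Δ|) ∉ ℚ²` (the crux's
  spelling), `ρ̄_{W⁄K,2ⁿ} : Γ_K → Aut(E(K̄)[2ⁿ])` is onto for every `n ≥ 1`.**

Mathematically: `Gal(K(E[2ⁿ])/K) = GL₂(ℤ/2ⁿ)` iff `K ⊄ ℚ(E[2ⁿ])`; the quadratic subfields of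
`ℚ(E[2^∞])` (full image) are the seven quadratic subfields of `ℚ(√−1, √2, √Δ)` ("`ℚ(E[8]) ⊃
ℚ(√Δ, √−1, √2)`", `GL₂(ℤ/8)/Φ = C₂³`); an imaginary `K` with ODD `d_K` is none of `ℚ(√−1)`, `ℚ(√±2)`,
and is `ℚ(√−|Δ|)` resp. `ℚ(√−2|Δ|)` exactly when `d_K·(−|Δ|)` resp. `d_K·(−2|Δ|)` is a square.

PROOF ROUTE (all inputs are tree theorems, proved there over any PERFECT field of characteristic `≠ 2`):
Dokchitser–Dokchitser's criteria over `K` — level `2` (`hasSurjectiveModNGaloisRep_two_of`), level `4`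
(`LevelFour.hasSurjectiveModNGaloisRep_four_iff_not_conj_subset_HH`), level `8`
(`hasSurjectiveModNGaloisRep_eight_iff_of_two_ne_zero`) and the mod-`8` lifting to all `2ⁿ`
(`surjective_of_surjective_castHom_eight_comp`, as in `hasSurjectiveModNGaloisRep_two_pow_of_eight_holds`)
— fed with:
* §1 `√−1, √2, √−2 ∉ K` for `d_K` odd (`Quadratic.discr_eq_four_mul_of_sq_eq_intCast`: they would force
  `d_K ∈ {−4, 8, −8}`), and "a rational non-square stays a non-square in `K` unless `d_K` times it is a
  square" (`KolyvaginImageTwo.isSquare_or_isSquare_mul_of_isSquare_algebraMap`), with the sign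
  bookkeeping turning the crux's `−|Δ|`, `−2|Δ|` into `±Δ`, `±2Δ`;
* §2 SQUARES: every square `B²` of an invertible matrix is `ρ̄_{W⁄K,m}(g)` for some `g ∈ Γ_K`
  (`RatClosure.exists_smul_eq_of_sq`: `ρ̄_{W,m}(Γ_ℚ) = Aut E[m]` and `[Γ_ℚ : Γ_K] = 2`), whence the square
  `(1 1; 0 1)² = 1 + 2E₁₂` of a transvection lies in `Im ρ̄_{W⁄K,4}` and is conjugate into
  Dokchitser–Dokchitser's exceptional `ℍ` by NO invertible `k` (`conj_klift`, `klift_mem_HH_imp`,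
  `mem_F4set_of_conj_mem`: a non-zero nilpotent of `M₂(𝔽₂)` is not in `𝔽₂[ω̄]`) — this replaces the
  `j ≠ −4t³(t + 8)` clause over `K`, which is not a statement about `ℚ`; level `2` over `K` is Dokchitser–
  Dokchitser (1) fed with the tree's `forall_two_nsmul_baseChange_of_hasSurjectiveModNGaloisRep_two_of_finrank_eq_two`
  and `GenusExact.not_isSquare_baseChange_Δ_of_not_isSquare` (as in the fkl line's
  `RankOneAtTwoOneDoor.hasSurjectiveModNGaloisRep_two_baseChange_of_not_isSquare`);
* §3–§5 the three levels and the tower. The companion file `…TwoAdicImageOverKH1.lean` feeds the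
  LEAD's `2·H¹(K(E[2^k])/K, E[2^k]) = 0` and `#H¹(Gal(L/K), E(L)[2^k]) ≤ 2` with this, OVER THE HEEGNER FIELD.

presearch: [corpus: paper:arxiv-1104.5031 p0001 L56–L66, L82–L95] gives the method over `ℚ`; the
over-`K` statement with the three side conditions is KNOWN-type bookkeeping (beyond-print theorem: no).

References: [DokchitserDokchitserMathZ2012] T. Dokchitser, V. Dokchitser, *Surjectivity of mod `2ⁿ`
representations of elliptic curves*, Math. Z. 272 (2012), Theorem and its proof;
[RouseZureickbrown2015] §3 Lemma (mod-`8` lifting); [GrossLMS1991] §9 (`𝒢 = Gal(L/K) ≅ GL₂` when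
`K ⊄ ℚ(E_p)`); [LawsonWuthrich2016] Lemma 3, §7.1.
-/

-- single-conjunct summit: `Summit.BirchSwinnertonDyer.BirchSwinnertonDyer.…` repeats the name by design
set_option linter.dupNamespace false
set_option autoImplicit false

noncomputable section

open scoped Classical

namespace Summit.BirchSwinnertonDyer.BirchSwinnertonDyer.Theorems.GenusKolyTwoAdicK

open WeierstrassCurve Field Matrix
open Literature.NumberTheory.EllipticCurves Literature.NumberTheory.GaloisRepresentations
open Literature.NumberTheory.EllipticCurves.DokchitserDokchitser2012
open Literature.NumberTheory.GaloisRepresentations.GL2Mod4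
open Literature.NumberTheory.GaloisRepresentations.GL2Mod8 (P4 P4.det)

universe u

/-! ### §1 Squares and non-squares in an imaginary quadratic field with odd discriminant -/

section Squares

variable {K : Type} [Field K] [NumberField K]

/-- **`√m ∉ K` for `m ≡ 2, 3 (mod 4)` squarefree when `d_K` is odd**: a square root `θ ∈ K` of such an
`m` forces `d_K = 4m` (Marcus, Ch. 2, Thm. 1 — tree `Quadratic.discr_eq_four_mul_of_sq_eq_intCast`),
which is even. [cite: Marcus2018, Ch. 2 Thm. 1] -/
theorem not_isSquare_intCast_of_odd_discr (hK2 : Module.finrank ℚ K = 2)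
    (hodd : Odd (NumberField.discr K)) {m : ℤ} (hm4 : m % 4 = 2 ∨ m % 4 = 3) (hsf : Squarefree m) :
    ¬ IsSquare ((m : ℤ) : K) := by
  rintro ⟨θ, hθ⟩
  have hsq : θ ^ 2 = ((m : ℤ) : K) := by rw [sq]; exact hθ.symm
  have h := Literature.NumberTheory.QuadraticFields.Quadratic.discr_eq_four_mul_of_sq_eq_intCast
    hK2 hsq hm4 hsf
  have h1 := Int.odd_iff.mp hodd
  rw [h] at h1
  omega

/-- `√−1 ∉ K` when `d_K` is odd (`K ≠ ℚ(i)`, `d_{ℚ(i)} = −4`). [cite: Marcus2018, Ch. 2 Thm. 1] -/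
theorem not_isSquare_neg_one_of_odd_discr (hK2 : Module.finrank ℚ K = 2)
    (hodd : Odd (NumberField.discr K)) : ¬ IsSquare (-1 : K) := by
  have h := not_isSquare_intCast_of_odd_discr hK2 hodd (m := -1) (Or.inr (by decide))
    (Int.squarefree_natAbs.mp (by simp))
  simpa using h

/-- `√2 ∉ K` when `d_K` is odd (`K ≠ ℚ(√2)`, `d_{ℚ(√2)} = 8`). [cite: Marcus2018, Ch. 2 Thm. 1] -/
theorem not_isSquare_two_of_odd_discr (hK2 : Module.finrank ℚ K = 2)
    (hodd : Odd (NumberField.discr K)) : ¬ IsSquare (2 : K) := by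
  have h := not_isSquare_intCast_of_odd_discr hK2 hodd (m := 2) (Or.inl (by decide))
    Int.prime_two.squarefree
  simpa using h

/-- `√−2 ∉ K` when `d_K` is odd (`K ≠ ℚ(√−2)`, `d_{ℚ(√−2)} = −8`). [cite: Marcus2018, Ch. 2 Thm. 1] -/
theorem not_isSquare_neg_two_of_odd_discr (hK2 : Module.finrank ℚ K = 2)
    (hodd : Odd (NumberField.discr K)) : ¬ IsSquare (-2 : K) := by
  have h := not_isSquare_intCast_of_odd_discr hK2 hodd (m := -2) (Or.inl (by decide))
    Int.prime_two.neg.squarefree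
  simpa using h

/-- **A rational non-square `r` with `d_K·r ∉ ℚ²` is not a square in `K`** (`[K : ℚ] = 2`):
the squares of `K` meeting `ℚ` are `ℚ² ∪ d_K·ℚ²`
(`KolyvaginImageTwo.isSquare_or_isSquare_mul_of_isSquare_algebraMap`). [folklore] -/
theorem not_isSquare_algebraMap_of (hK2 : Module.finrank ℚ K = 2) {r : ℚ} (hr : ¬ IsSquare r)
    (hdr : ¬ IsSquare ((NumberField.discr K : ℚ) * r)) : ¬ IsSquare (algebraMap ℚ K r) :=
  fun h ↦ (KolyvaginImageTwo.isSquare_or_isSquare_mul_of_isSquare_algebraMap K hK2 h).elim hr hdr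

/-- **Sign bookkeeping for the crux's side conditions.** For `d < 0` (the discriminant of an imaginary
quadratic field) and `x ≠ 0` (a discriminant `Δ`, or `2Δ`): `d·(−|x|) ∉ ℚ²` gives BOTH `d·x ∉ ℚ²` and
`d·(−x) ∉ ℚ²` — one of them is the hypothesis, the other is negative. [folklore] -/
theorem not_isSquare_mul_and_mul_neg_of_abs {d x : ℚ} (hd : d < 0) (hx : x ≠ 0)
    (h : ¬ IsSquare (d * -|x|)) : ¬ IsSquare (d * x) ∧ ¬ IsSquare (d * -x) := by
  rcases lt_or_gt_of_ne hx with hneg | hpos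
  · rw [abs_of_neg hneg, neg_neg] at h
    exact ⟨h, fun ⟨r, hr⟩ ↦ by nlinarith [mul_self_nonneg r]⟩
  · rw [abs_of_pos hpos] at h
    exact ⟨fun ⟨r, hr⟩ ↦ by nlinarith [mul_self_nonneg r], h⟩

end Squares

/-! ### §2 Squares of `Aut E[m]` are realised by `Γ_K` (matrix form) -/

section SquaresOfAut

variable {K : Type} [Field K] [NumberField K] (W : WeierstrassCurve ℚ) [W.IsElliptic]

omit [W.IsElliptic] in
/-- **Every square `B·B` of an invertible matrix is `ρ̄_{W⁄K,m}(g)` for some `g ∈ Γ_K`**, in any frame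
`e : E(K̄)[m] ≅ (ℤ/m)²`, when `ρ̄_{W,m} : Γ_ℚ → Aut E[m]` is onto and `[K : ℚ] = 2`: the additive
automorphism with matrix `B` (`toAut`) has its square realised by `Γ_K`
(`RatClosure.exists_smul_eq_of_sq`: `γ² ∈ res Γ_K` for every `γ ∈ Γ_ℚ`, the subgroup having index
`2`), and matrices multiply (`repMatrix_eq_mul_of`, `repMatrix_toAut`).
[cite: GrossLMS1991, §9 (before Prop. 9.1: ρ̄(Γ_K) ⊇ the squares)] -/
theorem exists_rhoMat_baseChange_eq_mul_self (hK2 : Module.finrank ℚ K = 2) {m : ℕ} [NeZero m]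
    (e : geomTorsion (W.baseChange K) m ≃+ (Fin 2 → ZMod m))
    (hρ : W.HasSurjectiveModNGaloisRep (m : ℤ)) (B : Matrix (Fin 2) (Fin 2) (ZMod m))
    {d' : ZMod m} (hd : B.det * d' = 1) :
    ∃ g : absoluteGaloisGroup K, rhoMat (W.baseChange K) e g = B * B := by
  obtain ⟨g, hg⟩ := RatClosure.exists_smul_eq_of_sq (K := K) W hK2 hρ (toAut e B d' hd)
  refine ⟨g, ?_⟩
  rw [rhoMat_apply, repMatrix_eq_mul_of e _ (toAut e B d' hd) (toAut e B d' hd) (fun P ↦ ?_),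
    repMatrix_toAut]
  rw [galoisRepTorsion_apply]
  exact hg P

end SquaresOfAut

/-! ### §3 Levels `4` and `8` over `K` -/

section Levels

variable {K : Type} [Field K] [NumberField K] (W : WeierstrassCurve ℚ) [W.IsElliptic]

omit [W.IsElliptic] in
/-- `Δ(W⁄K) = Δ(W)` viewed in `K`. [folklore] -/
theorem baseChange_Δ : (W.baseChange K).Δ = algebraMap ℚ K W.Δ := W.map_Δ _

/-- `(1 1; 0 1)² = 1 + 2E₁₂` is the kernel lift of the nilpotent `E₁₂ ∈ M₂(𝔽₂)`. [folklore] -/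
private theorem tup_transvection_sq :
    tup ((!![1, 1; 0, 1] : M4) * !![1, 1; 0, 1]) = klift ((0, 1, 0, 0) : P4) := by decide

/-- `E₁₂ ∉ 𝔽₂[ω̄] = {0, 1, ω̄, ω̄²}`. [folklore] -/
private theorem e12_not_mem_F4set : ((0, 1, 0, 0) : P4) ∉ F4set := by decide

/-- **The square of a transvection is conjugate into `ℍ` by no invertible `k`**: `k(1 + 2E₁₂)k⁻¹ =
1 + 2(k̄E₁₂k̄⁻¹)` (`conj_klift`), the kernel elements of `ℍ` are `1 + 2a`, `a ∈ 𝔽₂[ω̄]`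
(`klift_mem_HH_imp`), `𝔽₂[ω̄]` is conjugation-stable (`mem_F4set_of_conj_mem`) and `E₁₂ ∉ 𝔽₂[ω̄]`.
[cite: DokchitserDokchitserMathZ2012, proof of Theorem (2) (the subgroup ℍ of index 4)] -/
theorem tup_conj_transvection_sq_not_mem_HH (k : M4) (hk : k.det * k.det = 1) :
    tup (k * ((!![1, 1; 0, 1] : M4) * !![1, 1; 0, 1]) * inv' k) ∉ HH := by
  intro h
  have hk' : Q4.det (tup k) * Q4.det (tup k) = 1 := by rw [← det_eq]; exact hk
  rw [tup_mul, tup_mul, tup_inv', tup_transvection_sq, conj_klift _ hk'] at h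
  have hF := LevelFour.klift_mem_HH_imp _ h
  have hdet1 : P4.det (Q4.par (tup k)) = 1 := (Q4.det_mul_self_iff _).mp hk'
  exact e12_not_mem_F4set (LevelFour.mem_F4set_of_conj_mem _ hdet1 _ hF)

/-- **Level `4` over `K`.** For `W/ℚ` with `ρ̄_{W,4}` onto (hence `ρ̄_{W,2}` onto and `−Δ ∉ ℚ²`), `K` with
`[K : ℚ] = 2`, `d_K` odd (so `√−1 ∉ K`), `d_K·Δ ∉ ℚ²` and `d_K·(−Δ) ∉ ℚ²`: `ρ̄_{W⁄K,4}` is onto —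
Dokchitser–Dokchitser (2) over `K` in the tree's form "`ρ̄₂` onto, `−Δ ∉ K²`, and the image is not
conjugate into `ℍ`" (`LevelFour.hasSurjectiveModNGaloisRep_four_iff_not_conj_subset_HH`); the `ℍ`
alternative dies on the square of a transvection, which IS in the image over `K`
(`exists_rhoMat_baseChange_eq_mul_self`, `tup_conj_transvection_sq_not_mem_HH`).
[cite: DokchitserDokchitserMathZ2012, Theorem (2) and its proof] -/
theorem hasSurjectiveModNGaloisRep_baseChange_four (hK2 : Module.finrank ℚ K = 2)
    (hodd : Odd (NumberField.discr K)) (h4 : W.HasSurjectiveModNGaloisRep 4)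
    (hdΔ : ¬ IsSquare ((NumberField.discr K : ℚ) * W.Δ))
    (hdnΔ : ¬ IsSquare ((NumberField.discr K : ℚ) * -W.Δ)) :
    (W.baseChange K).HasSurjectiveModNGaloisRep 4 := by
  haveI : (W.baseChange K).IsElliptic := by rw [baseChange]; infer_instance
  haveI : PerfectField K := PerfectField.ofCharZero
  have h2s : W.HasSurjectiveModNGaloisRep 2 :=
    hasSurjectiveModNGaloisRep_two_of_four W (LevelFour.frame4 W two_ne_zero) h4
  refine (LevelFour.hasSurjectiveModNGaloisRep_four_iff_not_conj_subset_HH (W.baseChange K)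
    two_ne_zero (not_isSquare_neg_one_of_odd_discr hK2 hodd)).mpr ⟨?_, ?_, ?_⟩
  · -- level `2` over `K` (= the fkl line's `RankOneAtTwoOneDoor.hasSurjectiveModNGaloisRep_two_baseChange_of_not_isSquare`,
    -- composed here from its two inputs to keep this file's imports inside the genus route)
    exact hasSurjectiveModNGaloisRep_two_of (W.baseChange K) two_ne_zero
      (forall_two_nsmul_baseChange_of_hasSurjectiveModNGaloisRep_two_of_finrank_eq_two W h2s K hK2)
      (GenusExact.not_isSquare_baseChange_Δ_of_not_isSquare W K hK2 h2s hdΔ)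
  · rw [baseChange_Δ, ← map_neg]
    exact not_isSquare_algebraMap_of hK2
      (LevelFour.not_isSquare_neg_Δ_of_hasSurjectiveModNGaloisRep_four W two_ne_zero h4) hdnΔ
  · rintro ⟨k, hk, hall⟩
    have h4' : W.HasSurjectiveModNGaloisRep ((4 : ℕ) : ℤ) := by exact_mod_cast h4
    obtain ⟨g, hg⟩ := exists_rhoMat_baseChange_eq_mul_self W hK2
      (LevelFour.frame4 (W.baseChange K) two_ne_zero) h4' !![1, 1; 0, 1] (d' := 1) (by decide)
    have h := hall g
    have hM : LevelFour.M (W.baseChange K) two_ne_zero g = (!![1, 1; 0, 1] : M4) * !![1, 1; 0, 1] := hg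
    rw [hM] at h
    exact tup_conj_transvection_sq_not_mem_HH k hk h

/-- **Level `8` over `K`.** For `W/ℚ` with `ρ̄_{W,8}` onto (so `2Δ, −2Δ ∉ ℚ²`), `K` with `[K : ℚ] = 2` and
`d_K` odd (so `√2, √−2 ∉ K`), `ρ̄_{W⁄K,4}` onto, `d_K·2Δ ∉ ℚ²`, `d_K·(−2Δ) ∉ ℚ²`: `ρ̄_{W⁄K,8}` is onto —
Dokchitser–Dokchitser (3) over `K` (`hasSurjectiveModNGaloisRep_eight_iff_of_two_ne_zero`).
[cite: DokchitserDokchitserMathZ2012, Theorem (3) and its proof] -/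
theorem hasSurjectiveModNGaloisRep_baseChange_eight (hK2 : Module.finrank ℚ K = 2)
    (hodd : Odd (NumberField.discr K)) (h4K : (W.baseChange K).HasSurjectiveModNGaloisRep 4)
    (h8 : W.HasSurjectiveModNGaloisRep 8)
    (hd2Δ : ¬ IsSquare ((NumberField.discr K : ℚ) * (2 * W.Δ)))
    (hdn2Δ : ¬ IsSquare ((NumberField.discr K : ℚ) * (-2 * W.Δ))) :
    (W.baseChange K).HasSurjectiveModNGaloisRep 8 := by
  haveI : (W.baseChange K).IsElliptic := by rw [baseChange]; infer_instance
  haveI : PerfectField K := PerfectField.ofCharZero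
  obtain ⟨-, h2Δ, hn2Δ⟩ := (hasSurjectiveModNGaloisRep_eight_iff W).mp h8
  refine (hasSurjectiveModNGaloisRep_eight_iff_of_two_ne_zero (W.baseChange K) two_ne_zero
    (not_isSquare_two_of_odd_discr hK2 hodd) (not_isSquare_neg_two_of_odd_discr hK2 hodd)).mpr
    ⟨h4K, ?_, ?_⟩
  · rw [baseChange_Δ, show (2 : K) * algebraMap ℚ K W.Δ = algebraMap ℚ K (2 * W.Δ) by
      rw [map_mul, map_ofNat]]
    exact not_isSquare_algebraMap_of hK2 h2Δ hd2Δ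
  · rw [baseChange_Δ, show (-2 : K) * algebraMap ℚ K W.Δ = algebraMap ℚ K (-2 * W.Δ) by
      rw [map_mul, map_neg, map_ofNat]]
    exact not_isSquare_algebraMap_of hK2 hn2Δ hdn2Δ

end Levels

/-! ### §4 The tower: `ρ̄₈` onto ⟹ `ρ̄_{2ⁿ}` onto for all `n`, over any field with `2 ≠ 0` -/

section Tower

/-- **`ρ̄_{E,8}` onto ⟹ `ρ̄_{E,2ⁿ}` onto for every `n`, over ANY field `F` with `2 ≠ 0`** (Rouse–Zureick-Brown
§3 Lemma: a subgroup of `GL₂(ℤ/2ⁿ)`, `n ≥ 3`, mapping onto `GL₂(ℤ/8)` is everything — tree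
`surjective_of_surjective_castHom_eight_comp`; downward by `hasSurjectiveModNGaloisRep_pow_of_pow_add`;
`n = 0`: `E[1] = 0`). The tree's `hasSurjectiveModNGaloisRep_two_pow_of_eight_holds` is the case
`F = ℚ`; the proof is the same, its ingredients being field-general.
[cite: RouseZureickbrown2015, §3 Lemma (maximal subgroups ⊇ Γ(2^(k+1))) and §1]
[cite: DokchitserDokchitserMathZ2012, Introduction (p. 961)] -/
theorem hasSurjectiveModNGaloisRep_two_pow_of_eight_of_two_ne_zero {F : Type u} [Field F]
    (V : WeierstrassCurve F) [V.IsElliptic] (h2 : (2 : F) ≠ 0)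
    (h8 : V.HasSurjectiveModNGaloisRep 8) (n : ℕ) :
    V.HasSurjectiveModNGaloisRep ((2 : ℤ) ^ n) := by
  haveI : Fact (Nat.Prime 2) := ⟨Nat.prime_two⟩
  have h2F : ((2 : ℕ) : F) ≠ 0 := by exact_mod_cast h2
  have hcast : (((2 ^ n : ℕ) : ℤ)) = (2 : ℤ) ^ n := by push_cast; rfl
  rw [← hcast]
  have h8' : V.HasSurjectiveModNGaloisRep ((2 ^ 3 : ℕ) : ℤ) := by exact_mod_cast h8
  rcases Nat.lt_or_ge n 3 with hn | hn
  · interval_cases n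
    · haveI : Subsingleton (geomTorsion V ((2 ^ 0 : ℕ) : ℤ)) := ⟨fun a b ↦ by
        have ha := AddSubgroup.torsionBy.nsmul_iff.mp a.2
        have hb := AddSubgroup.torsionBy.nsmul_iff.mp b.2
        simp only [pow_zero, one_smul] at ha hb
        exact Subtype.ext (ha.trans hb.symm)⟩
      intro y
      exact ⟨1, Multiplicative.toAdd.injective (AddEquiv.ext fun a ↦ Subsingleton.elim _ _)⟩
    · exact hasSurjectiveModNGaloisRep_pow_of_pow_add V 2 1 2 one_pos h2F h8'
    · exact hasSurjectiveModNGaloisRep_pow_of_pow_add V 2 2 1 two_pos h2F h8'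
  · obtain ⟨j, rfl⟩ : ∃ j, n = 3 + j := ⟨n - 3, by omega⟩
    obtain ⟨e⟩ := nonempty_addEquiv_geomTorsion V 2 (3 + j) (by omega) h2F
    obtain ⟨ρ, hρ⟩ := exists_rep_of_addEquiv V e
    have hρsurj : Function.Surjective ρ := by
      refine surjective_of_surjective_castHom_eight_comp hn ρ (fun t ↦ ?_)
      obtain ⟨σ, hσ⟩ := exists_map_eq_of_hasSurjectiveModNGaloisRep_pow V 2 3 j h2F e ρ hρ h8' t
      exact ⟨σ, hσ⟩
    exact hasSurjectiveModNGaloisRep_of_rep_surjective V e ρ hρ hρsurj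

end Tower

/-! ### §5 The transfer `ℚ → K` on the crux habitat -/

section Transfer

variable {K : Type} [Field K] [NumberField K] (W : WeierstrassCurve ℚ) [W.IsElliptic]

/-- **The `2`-adic tower over a quadratic field, sign-free form.** For `W/ℚ` elliptic with `ρ̄_{W,2ⁿ}` onto
for all `n ≥ 1` and ANY quadratic field `K` (`[K : ℚ] = 2`) with `d_K` odd and `d_K·Δ`, `d_K·(−Δ)`,
`d_K·2Δ`, `d_K·(−2Δ) ∉ ℚ²` (i.e. `K ∉ {ℚ(√±Δ), ℚ(√±2Δ)}`; `K ∉ {ℚ(√−1), ℚ(√±2)}` being `d_K` odd):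
`ρ̄_{W⁄K,2ⁿ}` is onto for every `n ≥ 1`. [cite: DokchitserDokchitserMathZ2012, Theorem (1)–(3) and its proof] -/
theorem hasSurjectiveModNGaloisRep_baseChange_two_pow_of_finrank_eq_two (hK2 : Module.finrank ℚ K = 2)
    (hodd : Odd (NumberField.discr K))
    (hdΔ : ¬ IsSquare ((NumberField.discr K : ℚ) * W.Δ))
    (hdnΔ : ¬ IsSquare ((NumberField.discr K : ℚ) * -W.Δ))
    (hd2Δ : ¬ IsSquare ((NumberField.discr K : ℚ) * (2 * W.Δ)))
    (hdn2Δ : ¬ IsSquare ((NumberField.discr K : ℚ) * (-2 * W.Δ)))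
    (hρ : ∀ n : ℕ, 0 < n → W.HasSurjectiveModNGaloisRep ((2 : ℤ) ^ n)) :
    ∀ n : ℕ, 0 < n → (W.baseChange K).HasSurjectiveModNGaloisRep ((2 : ℤ) ^ n) := by
  haveI : (W.baseChange K).IsElliptic := by rw [baseChange]; infer_instance
  have h4 : W.HasSurjectiveModNGaloisRep 4 := by simpa using hρ 2 two_pos
  have h8 : W.HasSurjectiveModNGaloisRep 8 := by simpa using hρ 3 (by norm_num)
  have h4K := hasSurjectiveModNGaloisRep_baseChange_four W hK2 hodd h4 hdΔ hdnΔ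
  have h8K := hasSurjectiveModNGaloisRep_baseChange_eight W hK2 hodd h4K h8 hd2Δ hdn2Δ
  intro n _
  exact hasSurjectiveModNGaloisRep_two_pow_of_eight_of_two_ne_zero (W.baseChange K) two_ne_zero h8K n

/-- **THE `2`-ADIC IMAGE OVER THE HEEGNER FIELD.** Let `W/ℚ` be an elliptic curve with `ρ̄_{W,2ⁿ}` onto
for every `n ≥ 1` (the habitat's `2`-adic clause), and let `K` be an imaginary quadratic field with
`d_K` odd, `d_K·(−|Δ|) ∉ ℚ²` and `d_K·(−2|Δ|) ∉ ℚ²` (the three side conditions of the crux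
`GenusPrimitiveSupplyAtTwo` / (U) `MultiGenusPrimitivityAtTwo`, verbatim). Then
`ρ̄_{W⁄K,2ⁿ} : Γ_K → Aut(E(K̄)[2ⁿ])` is onto for every `n ≥ 1`, i.e. `Gal(K(E[2ⁿ])/K) ≅ GL₂(ℤ/2ⁿ)`
(`K ∩ ℚ(E[2^∞]) = ℚ`). Levels `2`, `4`, `8` by §3 (the side conditions, with `d_K < 0` and the sign of
`Δ`, give `d_K·(±Δ), d_K·(±2Δ) ∉ ℚ²`: `not_isSquare_mul_and_mul_neg_of_abs`), then the tower §4.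
[cite: DokchitserDokchitserMathZ2012, Theorem (1)–(3) and its proof (ℚ(E[8]) ⊃ ℚ(√Δ, √−1, √2))]
[cite: GrossLMS1991, §9 (𝒢 = Gal(L/K) ≅ GL₂)] -/
theorem hasSurjectiveModNGaloisRep_baseChange_two_pow (hK : IsImaginaryQuadratic K)
    (hodd : Odd (NumberField.discr K))
    (hnsq₁ : ¬ IsSquare ((NumberField.discr K : ℚ) * -|W.Δ|))
    (hnsq₂ : ¬ IsSquare ((NumberField.discr K : ℚ) * (-(2 * |W.Δ|))))
    (hρ : ∀ n : ℕ, 0 < n → W.HasSurjectiveModNGaloisRep ((2 : ℤ) ^ n)) :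
    ∀ n : ℕ, 0 < n → (W.baseChange K).HasSurjectiveModNGaloisRep ((2 : ℤ) ^ n) := by
  have hd : (NumberField.discr K : ℚ) < 0 := by exact_mod_cast hK.discr_neg
  have hΔ : W.Δ ≠ 0 := W.isUnit_Δ.ne_zero
  -- the four rational non-squares `d_K·(±Δ)`, `d_K·(±2Δ)`
  obtain ⟨hdΔ, hdnΔ⟩ := not_isSquare_mul_and_mul_neg_of_abs hd hΔ hnsq₁
  have h2abs : -(2 * |W.Δ|) = -|2 * W.Δ| := by
    rw [abs_mul, abs_of_pos (by norm_num : (0 : ℚ) < 2)]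
  rw [h2abs] at hnsq₂
  obtain ⟨hd2Δ, hdn2Δ⟩ := not_isSquare_mul_and_mul_neg_of_abs hd (mul_ne_zero two_ne_zero hΔ) hnsq₂
  rw [show -(2 * W.Δ) = -2 * W.Δ by ring] at hdn2Δ
  exact hasSurjectiveModNGaloisRep_baseChange_two_pow_of_finrank_eq_two W hK.1 hodd hdΔ hdnΔ hd2Δ
    hdn2Δ hρ

end Transfer

end Summit.BirchSwinnertonDyer.BirchSwinnertonDyer.Theorems.GenusKolyTwoAdicK

end
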